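/-
Copyright: the b2b-balaban cell (near-miss cell 7), T⁴-continuum fan-out, lineage t4-ne7b-p3 (node U5c LARGE-DEVIATION
member P3).  Released under the licence of the surrounding project.
-/
import Summits.QuantumFields.BalabanUV.T4Continuum.Support.SpaceTimeOccupancy
import Summits.QuantumFields.BalabanUV.T4Continuum.Support.SpaceTimeTorusDict
import Summits.QuantumFields.BalabanUV.T4Continuum.Support.SpaceTimeCellsVar
import Summits.QuantumFields.BalabanUV.T4Continuum.Support.SpaceTimeCover

/-!
# Space-time Peierls ∕ Cramér route for NE7b — THE OCCUPANCY MODEL ON THE TORUS FROM REALISED LINEAGES: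
# `cover` PROVED (vertical chain of the birth), and the cell binder under separation

Summits-side support leaf of the T⁴-continuum cell (rung (B)+1 on a FINITE torus only; NOT infinite volume, NOT the
mass gap, NOT the Clay statement; NOT a proof of the spine estimate NE7b).  Lineage `t4-ne7b-p3` (generation 2), node
U5c, skeleton `t4/skeletons/NE7b-t4-ne7b-p3.md` §11.  [folklore] finite combinatorics over `SpaceTimeOccupancy`
(`occAt`, `chainPt`), `SpaceTimeTorusDict` (`toCell`, `nearT_toCell_coarse`), `SpaceTimeCellsVar` (`STCellV`,
`stGraphV`), `SpaceTimeCover` (`contourCover_of_chains`), `SpaceTimeRealisedCells.treeCells_le`; nothing printed is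
asserted; no `[cite:]` tag.

WHAT.  `structure LinData`: the data of one run's terms and their LINEAGE FAMILIES realised in the index model (terms
`T`, lineages `fam τ`, genealogies `G`, ratios `q`, event steps and pieces) over the cutoff torus `n·L^{Kx}` with the
level map `ℓ` (`ℓ u ≤ Kx` on `u ≤ K`).
* §1 `LinData.cellOfLe u y` — the space-time cell (step `min u K`, torus cell of `y` at level `ℓ`) ; `LinData.InLin`,
  `LinData.occT` (a cell of `τ` is occupied iff it is the cell of an occupied index point of one of `τ`'s lineages),
  **`LinData.model : OccModel ι (STCellV d n L Kx K ℓ)`** (adjacency `stGraphV`, scale = step).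
* §2 **`LinData.contourCover`** — `cover` PROVED: if every bad term has a `SkelOK` lineage with an event born at a
  step `≤ jlo` with nonempty piece, then `model.ContourCover Bad jlo K` (the chain `u ↦ cell of chainPt u` is
  occupied by `chainPt_mem_occAt` and vertical by `nearT_toCell_coarse`; `contourCover_of_chains`).  Hypotheses on
  the levels: `ℓ` monotone and `q u = L^{ℓ(u+1) − ℓ u}`.
* §3 THE CELL BINDER UNDER SEPARATION: `LinData.Separated` (cells of distinct lineages of one term are distinct and
  not adjacent — the reading «distinct live components neither intersect nor touch»); `contour_subset_lineage` (a
  contour lies in ONE lineage's cells — walk propagation), `card_le_sum_occAt`, **`exists_lineage_card_le`**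
  (`#𝒦 ≤ treeCells (G λ) (K+1)`) and **`card_contour_le_tree`** (`#𝒦 ≤ 8·126^d·treeD + 126^d·treeSteps` at the cut
  `K + 1`, by `treeCells_le` under the drop control) — the cell clause of `LineageReadings.lineage` ON THE TORUS.

HONEST DEPENDENCY (cell, verbatim): continuum YM on T⁴ ⇐ BetaPertH ∧ nine spine estimates (0/9 proved); BetaPertH ⇐
(D1) ∧ (D4) ∧ CAP+tail; G-an2-4 gates asym, D1 and NE2/3/4.  This file changes none of it.
-/

open Finset

namespace Summit.QuantumFields.BalabanUV.T4Continuum.SpaceTimePeierls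

open Literature.MathematicalPhysics.QuantumFieldTheory.Balaban1983to89
open Literature.MathematicalPhysics.QuantumFieldTheory.Balaban1983to89.B13ScaleTransfer
open Literature.MathematicalPhysics.QuantumFieldTheory.Balaban1983to89.B16SProfile
open T4PersistenceDictionary
open Summit.QuantumFields.BalabanUV.T4Continuum.ZoneTorus
open SpaceTimePeierlsLeaves

noncomputable section

open Classical

/-! ## §1 The occupancy model on the torus from realised lineages -/

/-- **LINEAGE DATA OF ONE RUN** realised in the index model over the cutoff torus `n·L^{Kx}` with level map `ℓ`:
positivity of the torus side, levels inside the torus on `[0, K]`, the terms `T`, the lineages `fam τ` of each term,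
their genealogies `G`, the ratios `q`, the event steps and pieces. [folklore] -/
structure LinData (d n L Kx K : ℕ) (ℓ : ℕ → ℕ) (ι Λ ε : Type*) where
  /-- the torus is nonempty -/
  hN : 0 < n * L ^ Kx
  /-- the levels of the steps `≤ K` fit in the torus -/
  hℓK : ∀ u, u ≤ K → ℓ u ≤ Kx
  /-- the terms of the run -/
  T : Finset ι
  /-- the lineages (final live components) of a term -/
  fam : ι → Finset Λ
  /-- the genealogy of a lineage -/
  G : Λ → Gen ε
  /-- the ratios of consecutive cube sides -/
  q : ℕ → ℕ
  /-- the step of an event -/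
  step : ε → ℕ
  /-- the piece (index set) created by an event -/
  piece : ε → Finset (Pt d)

namespace LinData

variable {d n L Kx K : ℕ} {ℓ : ℕ → ℕ} {ι Λ ε : Type*} (D : LinData d n L Kx K ℓ ι Λ ε)

/-- **THE SPACE-TIME CELL OF AN INDEX POINT** at step `min u K`: its torus cell at level `ℓ (min u K)`. [folklore] -/
def cellOfLe (u : ℕ) (y : Pt d) : STCellV d n L Kx K ℓ :=
  ⟨(⟨min u K, by omega⟩, toCell (n * L ^ Kx) (L ^ ℓ (min u K)) D.hN y),
    isScale_toCell D.hN ((pow_dvd_pow L (D.hℓK _ (min_le_right u K))).mul_left n) y⟩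

/-- the step of the cell of an index point [folklore] -/
@[simp] theorem sc_cellOfLe (u : ℕ) (y : Pt d) : (D.cellOfLe u y).sc = min u K := rfl

/-- the torus cell of the cell of an index point [folklore] -/
theorem pt_cellOfLe (u : ℕ) (y : Pt d) :
    (D.cellOfLe u y).pt = toCell (n * L ^ Kx) (L ^ ℓ (min u K)) D.hN y := rfl

variable [DecidableEq ε]

/-- `D.InLin λ c`: the cell `c` is the cell of an index point occupied by the lineage `λ` at the step of `c`.
[folklore] -/
def InLin (lam : Λ) : STCellV d n L Kx K ℓ → Prop := fun c =>
  ∃ y ∈ occAt D.q D.step D.piece (D.G lam) c.sc, c.pt = toCell (n * L ^ Kx) (L ^ ℓ c.sc) D.hN y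

/-- **THE OCCUPIED CELLS OF A TERM**: the cells of the occupied index points of its lineages. [folklore] -/
def occT (τ : ι) : Finset (STCellV d n L Kx K ℓ) :=
  univ.filter fun c => ∃ lam ∈ D.fam τ, D.InLin lam c

/-- membership in the occupied cells [folklore] -/
theorem mem_occT {τ : ι} {c : STCellV d n L Kx K ℓ} : c ∈ D.occT τ ↔ ∃ lam ∈ D.fam τ, D.InLin lam c := by
  simp [occT]

/-- **THE OCCUPANCY MODEL ON THE TORUS** of the run: terms, occupied cells, the space-time cell graph with variable
blocking, scale = step. [folklore] -/
def model : OccModel ι (STCellV d n L Kx K ℓ) where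
  T := D.T
  Occ := D.occT
  Adj := stGraphV d n L Kx K ℓ
  scale := fun c => c.sc

/-- the cell of an occupied index point of a lineage of `τ` is occupied [folklore] -/
theorem cellOfLe_mem_occT {τ : ι} {lam : Λ} (hlam : lam ∈ D.fam τ) {u : ℕ} {y : Pt d}
    (hy : y ∈ occAt D.q D.step D.piece (D.G lam) (min u K)) : D.cellOfLe u y ∈ D.occT τ :=
  D.mem_occT.2 ⟨lam, hlam, y, hy, rfl⟩

/-! ## §2 `cover` proved: the vertical chain of the birth -/

variable {fat : ε → ℕ} {dC : ℝ}

/-- **`cover` PROVED ON THE TORUS.**  Levels monotone with `q u = L^{ℓ(u+1) − ℓ u}` (`n, L > 0`), `jlo ≤ K`,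
`Bad ⊆ T`, and every bad term has a `SkelOK` lineage with an event of step `≤ jlo` and nonempty piece (the OLD
structure of the bad term: born before `j⋆`): then every bad term has a contour meeting every scale of `[jlo, K]`.
[folklore] -/
theorem contourCover {Bad : Finset ι} {jlo : ℕ} (hn : 0 < n) (hL : 0 < L) (hmono : ∀ u, ℓ u ≤ ℓ (u + 1))
    (hq : ∀ u, D.q u = L ^ (ℓ (u + 1) - ℓ u)) (hBad : Bad ⊆ D.T) (hjlo : jlo ≤ K)
    (hold : ∀ τ ∈ Bad, ∃ lam ∈ D.fam τ, SkelOK D.q D.step D.piece fat dC (D.G lam) ∧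
      ∃ b ∈ (D.G lam).events, D.step b ≤ jlo ∧ (D.piece b).Nonempty) :
    D.model.ContourCover Bad jlo K := by
  refine D.model.contourCover_of_chains hBad hjlo fun τ hτ => ?_
  obtain ⟨lam, hlam, hok, b, hb, hbj, y, hy⟩ := hold τ hτ
  refine ⟨fun u => D.cellOfLe u (chainPt D.q (D.step b) y (min u K)), fun u hu1 hu2 => ⟨?_, ?_⟩,
    fun u hu1 hu2 => ?_⟩
  · exact D.cellOfLe_mem_occT hlam (chainPt_mem_occAt hok hb hy (by omega))
  · show min u K = u
    exact min_eq_left hu2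
  · have h1 : min u K = u := min_eq_left hu2.le
    have h2 : min (u + 1) K = u + 1 := min_eq_left hu2
    have hne : D.cellOfLe u (chainPt D.q (D.step b) y (min u K)) ≠
        D.cellOfLe (u + 1) (chainPt D.q (D.step b) y (min (u + 1) K)) := fun h => by
      have := congrArg STCellV.sc h
      simp only [sc_cellOfLe] at this
      omega
    show (stGraphV d n L Kx K ℓ).Adj _ _
    rw [stGraphV, SimpleGraph.fromRel_adj]
    refine ⟨hne, Or.inl (Or.inr ⟨?_, ?_⟩)⟩
    · show min u K + 1 = min (u + 1) K
      omega
    · show nearT n L Kx (toCell (n * L ^ Kx) (L ^ ℓ (min u K)) D.hN (chainPt D.q (D.step b) y (min u K)))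
        (ℓ (min u K)) (toCell (n * L ^ Kx) (L ^ ℓ (min (u + 1) K)) D.hN (chainPt D.q (D.step b) y (min (u + 1) K)))
        (ℓ (min (u + 1) K)) (ℓ (min (u + 1) K)) 0
      rw [h1, h2]
      obtain ⟨e, he⟩ : ∃ e, ℓ (u + 1) = ℓ u + e := ⟨ℓ (u + 1) - ℓ u, by have := hmono u; omega⟩
      have hKx : ℓ u + e ≤ Kx := by have := D.hℓK (u + 1) (by omega); omega
      have hc : chainPt D.q (D.step b) y (u + 1) = coarse (L ^ e) (chainPt D.q (D.step b) y u) := by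
        rw [← chainPt_succ D.q (show D.step b ≤ u by omega), hq u, he, Nat.add_sub_cancel_left]
      rw [he, hc]
      exact nearT_toCell_coarse hn hL hKx D.hN _

/-! ## §3 The cell binder under separation -/

/-- **SEPARATION** (the reading «distinct live components of one term neither intersect nor touch»): cells of
distinct lineages of the same term are distinct and not adjacent in the space-time cell graph. [folklore] -/
structure Separated : Prop where
  /-- cells of distinct lineages of one term are distinct and not adjacent -/
  sep : ∀ τ ∈ D.T, ∀ lam₁ ∈ D.fam τ, ∀ lam₂ ∈ D.fam τ, lam₁ ≠ lam₂ → ∀ c₁ c₂ : STCellV d n L Kx K ℓ,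
    D.InLin lam₁ c₁ → D.InLin lam₂ c₂ → c₁ ≠ c₂ ∧ ¬ (stGraphV d n L Kx K ℓ).Adj c₁ c₂

/-- propagation of a property along a walk [folklore] -/
theorem walk_propagate {V : Type*} {Gr : SimpleGraph V} {P : V → Prop} (h : ∀ v w, Gr.Adj v w → P v → P w) :
    ∀ {v w : V}, Gr.Walk v w → P v → P w
  | _, _, SimpleGraph.Walk.nil, hv => hv
  | _, _, SimpleGraph.Walk.cons hadj p, hv => walk_propagate h p (h _ _ hadj hv)

/-- **A CONTOUR LIES IN ONE LINEAGE** under separation: a connected occupied set cannot cross from one lineage's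
cells to another's (no common cell, no edge). [folklore] -/
theorem contour_subset_lineage (hsep : D.Separated) {τ : ι} (hτ : τ ∈ D.T) {𝒦 : Finset (STCellV d n L Kx K ℓ)}
    (h𝒦 : D.model.IsContour τ 𝒦) : ∃ lam ∈ D.fam τ, ∀ c ∈ 𝒦, D.InLin lam c := by
  obtain ⟨hsub, ⟨c₀, hc₀⟩, hconn, -⟩ := h𝒦
  obtain ⟨lam₀, hlam₀, hin₀⟩ := D.mem_occT.1 (hsub hc₀)
  refine ⟨lam₀, hlam₀, fun c hc => ?_⟩
  obtain ⟨p⟩ := hconn.preconnected ⟨c₀, mem_coe.2 hc₀⟩ ⟨c, mem_coe.2 hc⟩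
  refine walk_propagate (Gr := D.model.Adj.induce (𝒦 : Set (STCellV d n L Kx K ℓ))) (P := fun v => D.InLin lam₀ v.1)
    (fun v w hadj hv => ?_) p hin₀
  rw [SimpleGraph.induce_adj] at hadj
  obtain ⟨lam', hlam', hin'⟩ := D.mem_occT.1 (hsub (mem_coe.1 w.2))
  by_cases heq : lam₀ = lam'
  · rw [heq]; exact hin'
  · exact absurd hadj (hsep.sep τ hτ lam₀ hlam₀ lam' hlam' heq v.1 w.1 hv hin').2

/-- **THE CELLS OF ONE LINEAGE ARE COUNTED BY ITS OCCUPIED INDEX SETS**: a set of cells all in the lineage `λ` has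
at most `Σ_{u ≤ K} #occAt (G λ) u` elements. [folklore] -/
theorem card_le_sum_occAt (lam : Λ) {𝒦 : Finset (STCellV d n L Kx K ℓ)} (h : ∀ c ∈ 𝒦, D.InLin lam c) :
    (𝒦.card : ℝ) ≤ ∑ u ∈ range (K + 1), ((occAt D.q D.step D.piece (D.G lam) u).card : ℝ) := by
  have hsub : 𝒦 ⊆ (range (K + 1)).biUnion fun u => (occAt D.q D.step D.piece (D.G lam) u).image (D.cellOfLe u) := by
    intro c hc
    obtain ⟨y, hy, hpt⟩ := h c hc
    have hcK : c.sc ≤ K := Nat.le_of_lt_succ c.1.1.isLt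
    rw [mem_biUnion]
    refine ⟨c.sc, mem_range.2 (by omega), mem_image.2 ⟨y, hy, ?_⟩⟩
    apply STCellV.ext_of
    · show min c.sc K = c.sc
      exact min_eq_left hcK
    · rw [pt_cellOfLe, min_eq_left hcK, hpt]
  have h1 := card_le_card hsub
  have h2 := (card_biUnion_le (s := range (K + 1))
    (t := fun u => (occAt D.q D.step D.piece (D.G lam) u).image (D.cellOfLe u)))
  have h3 : ∑ u ∈ range (K + 1), ((occAt D.q D.step D.piece (D.G lam) u).image (D.cellOfLe u)).card ≤
      ∑ u ∈ range (K + 1), (occAt D.q D.step D.piece (D.G lam) u).card :=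
    sum_le_sum fun u _ => card_image_le
  exact_mod_cast h1.trans (h2.trans h3)

/-- **THE CELL BINDER ON THE TORUS, I**: under separation every contour of a term lies in one of its lineages and
has at most `treeCells (G λ) (K + 1)` cells. [folklore] -/
theorem exists_lineage_card_le (hsep : D.Separated) {τ : ι} (hτ : τ ∈ D.T) {𝒦 : Finset (STCellV d n L Kx K ℓ)}
    (h𝒦 : D.model.IsContour τ 𝒦) :
    ∃ lam ∈ D.fam τ, (∀ c ∈ 𝒦, D.InLin lam c) ∧
      (𝒦.card : ℝ) ≤ treeCells D.q D.step D.piece (D.G lam) (K + 1) := by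
  obtain ⟨lam, hlam, hin⟩ := D.contour_subset_lineage hsep hτ h𝒦
  exact ⟨lam, hlam, hin, (D.card_le_sum_occAt lam hin).trans (sum_card_occAt_le_treeCells _ _)⟩

/-- **THE CELL BINDER ON THE TORUS, II** (the cell clause of `LineageReadings.lineage` at the cut `K + 1`): with
the typed ratios `q = ratio L σ` under the drop control `DropCtl σ m` (`L ≥ 4`, `K ≤ m`, `0 ≤ dC`) and `SkelOK`
lineages, every contour of a term lies in one lineage `λ` with
`#𝒦 ≤ 8·126^d · treeD (G λ) (K+1) + 126^d · treeSteps (G λ) (K+1)`. [folklore] -/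
theorem card_contour_le_tree (hsep : D.Separated) {τ : ι} (hτ : τ ∈ D.T) {𝒦 : Finset (STCellV d n L Kx K ℓ)}
    (h𝒦 : D.model.IsContour τ 𝒦) {σ : ℕ → ℕ} {m : ℕ} (hL : 4 ≤ L) (hq : D.q = ratio L σ) (hdrop : DropCtl σ m)
    (hK : K ≤ m) (hdC : 0 ≤ dC) (hok : ∀ lam ∈ D.fam τ, SkelOK D.q D.step D.piece fat dC (D.G lam)) :
    ∃ lam ∈ D.fam τ, (∀ c ∈ 𝒦, D.InLin lam c) ∧
      (𝒦.card : ℝ) ≤ 8 * 126 ^ d * treeD fat D.step dC (D.G lam) (K + 1) + 126 ^ d * treeSteps D.step (D.G lam) (K + 1) := by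
  obtain ⟨lam, hlam, hin, hle⟩ := D.exists_lineage_card_le hsep hτ h𝒦
  refine ⟨lam, hlam, hin, hle.trans ?_⟩
  have hok' := hok lam hlam
  rw [hq] at hok' ⊢
  exact treeCells_le hL hdrop hdC hok' (by omega)

end LinData

end

end Summit.QuantumFields.BalabanUV.T4Continuum.SpaceTimePeierls
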